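import Mathlib.Analysis.SpecialFunctions.Pow.Real
import HarnessLib

/-!
# Set-up lemmas for the topological engulfing engine

An elementary ingredient of the proof of Rushing's topological engulfing theorem
(Rushing 1973, Thm. 4.12.1): the `m`-fold refinement of a strictly increasing partition
`t 0 < t 1 < ⋯` (the partition `0 = t₀ < t₁ < ⋯ < t_v = 1` "fine enough", refined again at each
cell in the engine), with its index arithmetic.  (The other set-up ingredient, charts read as
open embeddings `ℝⁿ → M` through every point, is the tree's
`Literature.AlgebraicTopology.Homotopy.exists_isOpenEmbedding_apply_zero_eq`.)  Everything is
proved; `finePartition` is an explicit definition; no named facts.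

## References

* T. B. Rushing, *Topological Embeddings*, Academic Press (1973), proof of Thm. 4.12.1
  (p. 201–202: the partition `t_0 < ⋯ < t_v`). [Rushing1973]
-/

open Set Function

noncomputable section

namespace Literature.Topology.FourManifolds

/-! ### Refining a partition -/

/-- **The `m`-fold refinement** of a partition `t`: the slab `[t a, t (a+1)]` is cut into `m`
equal pieces, `finePartition t m (a * m + j) = t a + j • (t (a+1) - t a) / m`. [folklore] -/
def finePartition (t : ℕ → ℝ) (m : ℕ) (k : ℕ) : ℝ :=
  t (k / m) + ((k % m : ℕ) : ℝ) * ((t (k / m + 1) - t (k / m)) / m)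

/-- The refinement passes through the original levels. [folklore] -/
theorem finePartition_mul {t : ℕ → ℝ} {m : ℕ} (hm : 0 < m) (a : ℕ) :
    finePartition t m (a * m) = t a := by
  simp [finePartition, Nat.mul_div_cancel a hm, Nat.mul_mod_left]

/-- Values inside a slab. [folklore] -/
theorem finePartition_mul_add {t : ℕ → ℝ} {m : ℕ} (a : ℕ) {j : ℕ} (hj : j < m) :
    finePartition t m (a * m + j) = t a + (j : ℝ) * ((t (a + 1) - t a) / m) := by
  have hm : 0 < m := lt_of_le_of_lt (Nat.zero_le j) hj
  have hdiv : (a * m + j) / m = a := by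
    rw [Nat.add_comm, Nat.add_mul_div_right _ _ hm, Nat.div_eq_of_lt hj, zero_add]
  have hmod : (a * m + j) % m = j := by
    rw [Nat.add_comm, Nat.add_mul_mod_self_right, Nat.mod_eq_of_lt hj]
  rw [finePartition, hdiv, hmod]

/-- **The refinement is strictly increasing** when the partition is. [folklore] -/
theorem strictMono_finePartition {t : ℕ → ℝ} (ht : StrictMono t) {m : ℕ} (hm : 0 < m) :
    StrictMono (finePartition t m) := by
  refine strictMono_nat_of_lt_succ fun k => ?_
  -- write `k = a m + j`
  set a := k / m with ha
  set j := k % m with hj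
  have hk : k = a * m + j := by rw [ha, hj, Nat.div_add_mod' k m]
  have hjm : j < m := Nat.mod_lt k hm
  have hstep : 0 < (t (a + 1) - t a) / m := div_pos (sub_pos.2 (ht (Nat.lt_succ_self a))) (Nat.cast_pos.2 hm)
  rw [hk, finePartition_mul_add a hjm]
  rcases Nat.lt_or_ge (j + 1) m with h1 | h1
  · rw [show a * m + j + 1 = a * m + (j + 1) from by ring, finePartition_mul_add a h1]
    push_cast
    nlinarith
  · have hj1 : j + 1 = m := le_antisymm hjm h1
    rw [show a * m + j + 1 = (a + 1) * m from by rw [add_assoc, hj1]; ring, finePartition_mul hm]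
    -- `t a + j • step < t (a+1)` since `j < m`
    have hm' : (m : ℝ) ≠ 0 := (Nat.cast_pos.2 hm).ne'
    have : (j : ℝ) * ((t (a + 1) - t a) / m) < (m : ℝ) * ((t (a + 1) - t a) / m) :=
      mul_lt_mul_of_pos_right (Nat.cast_lt.2 hjm) hstep
    rw [mul_div_cancel₀ _ hm'] at this
    linarith

/-- Fine levels of a slab lie in the slab. [folklore] -/
theorem finePartition_mem_Icc {t : ℕ → ℝ} (ht : StrictMono t) {m : ℕ} (a : ℕ) {j : ℕ} (hj : j ≤ m)
    (hm : 0 < m) : finePartition t m (a * m + j) ∈ Icc (t a) (t (a + 1)) := by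
  rcases hj.lt_or_eq with hlt | hjm
  · rw [finePartition_mul_add a hlt]
    have hstep : 0 ≤ (t (a + 1) - t a) / m :=
      div_nonneg (sub_nonneg.2 (ht (Nat.lt_succ_self a)).le) (Nat.cast_nonneg m)
    refine ⟨le_add_of_nonneg_right (mul_nonneg (Nat.cast_nonneg j) hstep), ?_⟩
    have hm' : (m : ℝ) ≠ 0 := (Nat.cast_pos.2 hm).ne'
    have : (j : ℝ) * ((t (a + 1) - t a) / m) ≤ (m : ℝ) * ((t (a + 1) - t a) / m) :=
      mul_le_mul_of_nonneg_right (Nat.cast_le.2 hlt.le) hstep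
    rw [mul_div_cancel₀ _ hm'] at this
    linarith
  · rw [hjm, show a * m + m = (a + 1) * m from by ring, finePartition_mul hm]
    exact ⟨(ht (Nat.lt_succ_self a)).le, le_rfl⟩

/-- **Mesh of the refinement**: consecutive fine levels differ by `(t (a+1) - t a) / m`.
[folklore] -/
theorem finePartition_succ_sub {t : ℕ → ℝ} {m : ℕ} (hm : 0 < m) (k : ℕ) :
    finePartition t m (k + 1) - finePartition t m k = (t (k / m + 1) - t (k / m)) / m := by
  set a := k / m with ha
  set j := k % m with hj
  have hk : k = a * m + j := by rw [ha, hj, Nat.div_add_mod' k m]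
  have hjm : j < m := Nat.mod_lt k hm
  rw [hk, finePartition_mul_add a hjm]
  rcases Nat.lt_or_ge (j + 1) m with h1 | h1
  · rw [show a * m + j + 1 = a * m + (j + 1) from by ring, finePartition_mul_add a h1]
    push_cast; ring
  · have hj1 : j + 1 = m := le_antisymm hjm h1
    rw [show a * m + j + 1 = (a + 1) * m from by rw [add_assoc, hj1]; ring, finePartition_mul hm]
    have hm' : (m : ℝ) ≠ 0 := (Nat.cast_pos.2 hm).ne'
    have hjr : (j : ℝ) = m - 1 := by
      have : ((j + 1 : ℕ) : ℝ) = m := by rw [hj1]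
      push_cast at this; linarith
    rw [hjr]
    field_simp
    ring

end Literature.Topology.FourManifolds
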